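import Literature.MathematicalPhysics.QuantumLattice.GrassmannKernelsPresented

/-!
# The kernel expansion (reconstruction) theorem `F = Σ_m Σ_Y kernel F m Y · ψ(Y_0)⋯ψ(Y_{m-1})`
# (crux `SeededBrokenRegimeBoseFermiPinned` = stmt-HubbardSuperconductivity-14047, route AposterioriCapRg; supports, lead c4)

Restatement-invariant analysis layer: the bridge between an element `F` of the Grassmann algebra on the
finite label set `Γ` and its antisymmetric kernels.  In the tree's vocabulary
(`kernel R F m X = (m!)⁻¹ · constPart (∂_{X_{m-1}} ⋯ ∂_{X_0} F)`, `GrassmannKernels.lean`;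
`presented R φ = Σ_Y φ(Y) • ψ(Y_0)⋯ψ(Y_{m-1})`, `GrassmannKernelsPresented.lean`) the theorem reads
`F = Σ_{m ≤ |Γ|} presented R (kernel R F m)` (Salmhofer 1998, (3.12); Salmhofer 1999, (4.95): every
Grassmann polynomial is the sum over the degree of its kernels integrated against the monomials).  Every
`L¹–L^∞` estimate of a product, or of Polchinski's bilinear term, goes through it.

Proof.  Both sides are `R`-linear in `F`, so it suffices to treat a spanning family; we take the monomial
basis `grassmannBasis` (increasing products of generators, for an auxiliary linear order on `Γ`), whose
vectors are products `genProd R Y` of `|s| ≤ |Γ|` generators, i.e. presented polynomials with a delta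
presentation.  For a presented polynomial of degree `k` the kernels vanish in the degrees `m ≠ k`
(`kernel_presented_of_ne`), and in degree `k` the kernel is the antisymmetrisation
`(k!)⁻¹ Σ_σ sign σ · φ(X ∘ σ)` (`kernel_presented`); re-presenting it gives back `presented R φ` because
`genProd` is antisymmetric (`genProd R (Y ∘ σ) = sign σ • genProd R Y`, the alternating property of
`ExteriorAlgebra.ιMulti`) and `Σ_σ (k!)⁻¹ = 1`.

* `KernelExpansion.genProd_comp_perm` — antisymmetry of a product of generators;
* `KernelExpansion.presented_kernel_presented` — `presented (kernel (presented φ) k) = presented φ`;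
* `KernelExpansion.eq_sum_presented_kernel` — the theorem; registered stub `stub_eq_sum_presented_kernel`.

Sources: M. Salmhofer, Commun. Math. Phys. 194 (1998) 249–295, §3.2 (3.12) [`Salmhofer1998`];
M. Salmhofer, *Renormalization* (1999), §4.3 (4.95) [`Salmhofer1999`]; F. A. Berezin, *The Method of Second
Quantization* (1966), Ch. I §3 (3.3).  Finite-dimensional linear algebra; folklore.
-/

set_option linter.dupNamespace false -- `Summit.<S>.<S>` doubles the summit name (tree convention)

namespace Summit.HubbardSuperconductivity.HubbardSuperconductivity.Theorems.AposterioriCapRgSeededBrokenRegimeBoseFermiPinned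

open Literature.MathematicalPhysics.QuantumLattice GrassmannAlgebra

namespace KernelExpansion

variable {R : Type*} [CommRing R] {Γ : Type*} [DecidableEq Γ]

/-- A product of generators is the alternating map `ιMulti` on the coordinate vectors:
`ψ(Y_0)⋯ψ(Y_{k-1}) = ιMulti (e_{Y_0}, …, e_{Y_{k-1}})`. [folklore] -/
theorem genProd_eq_ιMulti {k : ℕ} (Y : Fin k → Γ) :
    genProd R Y = ExteriorAlgebra.ιMulti R k fun i => (Pi.single (Y i) (1 : R) : Γ → R) := by
  rw [ExteriorAlgebra.ιMulti_apply]
  rfl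

/-- **Antisymmetry of a product of generators**: `ψ(Y_{σ 0})⋯ψ(Y_{σ(k-1)}) = sign σ · ψ(Y_0)⋯ψ(Y_{k-1})`.
[folklore] -/
theorem genProd_comp_perm {k : ℕ} (Y : Fin k → Γ) (σ : Equiv.Perm (Fin k)) :
    genProd R (Y ∘ σ) = ((Equiv.Perm.sign σ : ℤ) : R) • genProd R Y := by
  rw [genProd_eq_ιMulti, genProd_eq_ιMulti, Int.cast_smul_eq_zsmul R, ← Units.smul_def]
  exact AlternatingMap.map_perm (ExteriorAlgebra.ιMulti R k) (fun i => (Pi.single (Y i) (1 : R) : Γ → R)) σ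

variable [Fintype Γ]

/-- `presented` is additive in the presentation. [folklore] -/
theorem presented_add {k : ℕ} (φ ψ : (Fin k → Γ) → R) :
    presented R (φ + ψ) = presented R φ + presented R ψ := by
  simp only [presented, Pi.add_apply, add_smul, Finset.sum_add_distrib]

/-- `presented` is homogeneous in the presentation. [folklore] -/
theorem presented_smul {k : ℕ} (r : R) (φ : (Fin k → Γ) → R) :
    presented R (r • φ) = r • presented R φ := by
  simp only [presented, Pi.smul_apply, smul_eq_mul, mul_smul, Finset.smul_sum]

/-- The zero presentation presents `0`. [folklore] -/
theorem presented_zero {k : ℕ} : presented R (0 : (Fin k → Γ) → R) = 0 := by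
  simp [presented]

/-- A product of generators is presented by a delta presentation. [folklore] -/
theorem genProd_eq_presented_single {k : ℕ} (Y : Fin k → Γ) :
    genProd R Y = presented R (Pi.single Y (1 : R)) := by
  rw [presented, Finset.sum_eq_single Y (fun Z _ hZ => by rw [Pi.single_eq_of_ne hZ, zero_smul])
    (fun h => absurd (Finset.mem_univ Y) h), Pi.single_eq_same, one_smul]

/-- **Re-indexing a presentation by a permutation of the slots**:
`Σ_X φ(X ∘ σ) • ψ(X) = sign σ • presented φ` (substitute `X = Z ∘ σ⁻¹` and use antisymmetry). [folklore] -/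
theorem sum_comp_perm_smul_genProd {k : ℕ} (φ : (Fin k → Γ) → R) (σ : Equiv.Perm (Fin k)) :
    ∑ X : Fin k → Γ, φ (X ∘ σ) • genProd R X = ((Equiv.Perm.sign σ : ℤ) : R) • presented R φ := by
  rw [presented, Finset.smul_sum]
  refine Fintype.sum_bijective (fun X : Fin k → Γ => X ∘ σ)
    (Function.bijective_iff_has_inverse.2 ⟨fun Z => Z ∘ σ.symm, fun X => ?_, fun Z => ?_⟩) _ _ fun X => ?_
  · funext i
    simp
  · funext i
    simp
  · rw [genProd_comp_perm, smul_smul, smul_smul, mul_right_comm, ← Int.cast_mul, Int.units_coe_mul_self,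
      Int.cast_one, one_mul]

/-- A monomial basis vector is the increasing product of its generators, as a `genProd`. [folklore] -/
theorem grassmannBasis_eq_genProd [LinearOrder Γ] (s : Finset Γ) :
    grassmannBasis R Γ s = genProd R (fun i : Fin s.card => s.orderEmbOfFin rfl i) := by
  rw [grassmannBasis, ExteriorAlgebra.basis_apply_ofCard (Pi.basisFun R Γ) rfl, ExteriorAlgebra.ιMulti_family,
    genProd_eq_ιMulti]
  congr 1 with i
  simp [Set.powersetCard.ofFinEmbEquiv_symm_apply, Pi.basisFun_apply]

variable [Algebra ℚ R]

/-- **Re-presenting the kernel of a presented polynomial gives it back**: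
`presented (kernel (presented φ) k) = presented φ` — the antisymmetrisation `(k!)⁻¹ Σ_σ sign σ · φ(X ∘ σ)`
presents the same polynomial as `φ`. [cite: Salmhofer1999, §4.3 (4.95)] -/
theorem presented_kernel_presented {k : ℕ} (φ : (Fin k → Γ) → R) :
    presented R (kernel R (presented R φ) k) = presented R φ := by
  have hk : kernel R (presented R φ) k = fun X =>
      ((k.factorial : ℚ)⁻¹ • (1 : R)) * ∑ σ : Equiv.Perm (Fin k), ((Equiv.Perm.sign σ : ℤ) : R) * φ (X ∘ σ) := by
    funext X
    rw [kernel_presented]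
    simp only [Units.smul_def, zsmul_eq_mul]
  have hc : ((k.factorial : ℚ)⁻¹ • (1 : R)) * ((k.factorial : ℕ) : R) = 1 := by
    rw [← mul_one ((k.factorial : ℕ) : R), ← nsmul_eq_mul, ← Nat.cast_smul_eq_nsmul ℚ, smul_mul_smul_comm,
      one_mul, inv_mul_cancel₀ (by positivity), one_smul]
  conv_lhs => rw [hk, presented]
  simp_rw [mul_smul, ← Finset.smul_sum, Finset.sum_smul]
  rw [Finset.sum_comm]
  simp_rw [mul_smul, ← Finset.smul_sum, sum_comp_perm_smul_genProd, smul_smul, ← Int.cast_mul,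
    Int.units_coe_mul_self, Int.cast_one, one_smul, Finset.sum_const, Finset.card_univ, Fintype.card_perm,
    Fintype.card_fin, ← Nat.cast_smul_eq_nsmul R, smul_smul, hc, one_smul]

/-- The expansion theorem on a presented polynomial of degree `k ≤ |Γ|`: only the degree `k` survives.
[cite: Salmhofer1998, §3.2 (3.12)] -/
theorem presented_eq_sum_presented_kernel {k : ℕ} (φ : (Fin k → Γ) → R) (hk : k ≤ Fintype.card Γ) :
    presented R φ = ∑ m ∈ Finset.range (Fintype.card Γ + 1), presented R (kernel R (presented R φ) m) := by
  rw [Finset.sum_eq_single_of_mem k (Finset.mem_range.2 (Nat.lt_succ_of_le hk)) fun m _ hmk => ?_,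
    presented_kernel_presented]
  have h0 : kernel R (presented R φ) m = 0 := funext fun X => kernel_presented_of_ne R φ X hmk
  rw [h0, presented_zero]

/-- The expansion theorem on a monomial basis vector. [cite: Salmhofer1998, §3.2 (3.12)] -/
theorem grassmannBasis_eq_sum_presented_kernel [LinearOrder Γ] (s : Finset Γ) :
    grassmannBasis R Γ s =
      ∑ m ∈ Finset.range (Fintype.card Γ + 1), presented R (kernel R (grassmannBasis R Γ s) m) := by
  rw [grassmannBasis_eq_genProd s, genProd_eq_presented_single]
  exact presented_eq_sum_presented_kernel _ (Finset.card_le_univ s)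

/-- **The kernel expansion theorem** `F = Σ_{m ≤ |Γ|} Σ_Y kernel F m Y · ψ(Y_0)⋯ψ(Y_{m-1})`
(Salmhofer 1998, (3.12); Salmhofer 1999, (4.95)). [cite: Salmhofer1998, §3.2 (3.12)] -/
theorem eq_sum_presented_kernel (F : GrassmannAlgebra R Γ) :
    F = ∑ m ∈ Finset.range (Fintype.card Γ + 1), presented R (kernel R F m) := by
  letI : LinearOrder Γ := LinearOrder.lift' (Fintype.equivFin Γ) (Fintype.equivFin Γ).injective
  have hF := (grassmannBasis R Γ).mem_span F
  induction hF using Submodule.span_induction with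
  | mem x hx =>
    obtain ⟨s, rfl⟩ := hx
    exact grassmannBasis_eq_sum_presented_kernel s
  | zero => simp [presented]
  | add x y _ _ hx hy =>
    conv_lhs => rw [hx, hy]
    rw [← Finset.sum_add_distrib]
    refine Finset.sum_congr rfl fun m _ => ?_
    rw [← presented_add]
    congr 1
    funext X
    rw [Pi.add_apply, kernel_add]
  | smul r x _ hx =>
    conv_lhs => rw [hx]
    rw [Finset.smul_sum]
    refine Finset.sum_congr rfl fun m _ => ?_
    rw [← presented_smul]
    congr 1
    funext X
    rw [Pi.smul_apply, smul_eq_mul, kernel_smul]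

end KernelExpansion

/-! ### The registered stub -/

/-- **W3 (`stub_eq_sum_presented_kernel`)**: the kernel expansion theorem
`F = Σ_{m ≤ |Γ|} presented R (kernel R F m)`. [cite: Salmhofer1998, §3.2 (3.12)] -/
theorem stub_eq_sum_presented_kernel :
    ∀ {R : Type} [CommRing R] [Algebra ℚ R] {Γ : Type} [Fintype Γ] [DecidableEq Γ] (F : GrassmannAlgebra R Γ),
      F = ∑ m ∈ Finset.range (Fintype.card Γ + 1), presented R (kernel R F m) := by
  intro R _ _ Γ _ _ F
  exact KernelExpansion.eq_sum_presented_kernel F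

end Summit.HubbardSuperconductivity.HubbardSuperconductivity.Theorems.AposterioriCapRgSeededBrokenRegimeBoseFermiPinned
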